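import Mathlib
import Summits.Parity.GeneralizedHardyLittlewood.Theses.LiouvilleMAD
import Literature.NumberTheory.Sieve.RamanujanSum

/-!
# Sketch (ideator 1, round 1) — crux stmt-Parity-13317 `CosetDecorrelation` (route LiouvilleMAD)

First lemmas of the crux idea card `shells-and-shifts` (Ideas/shells-and-shifts.md), stated as
`Prop`s over existing declarations; PROVED here: `shellIdentity_holds` (L1, the card's FIRST LEMMA,
via `shell_identity_general` for arbitrary finsets/sequences, Kluyver `sum_divisors_ramanujanSum_real`
and periodicity `ramanujanSum_congr`), `cosetAsInnerProduct_holds` (L0), `meanFluctuation_holds` (L2);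
everything elaborates, `lean check` rc 0, 0 sorry.

Notation (route docstring): `u(m) = λ(mn+c)`, `v(m) = λ(mn'+c)` on `m ∈ (M, 2M]`;
`U_a = Σ_{m ≡ a (d)} u(m)` (class sums), `T_d = Σ_{m ≡ m' (mod d)} u(m) v(m')` (coset sum; the crux
bounds `T_j`, `j ∈ [Q, 2Q)`, `Q = ⌊√M⌋+1`, by `C·M^{3/4+ϑ}`, `ϑ < 1/4`).

* `CosetAsInnerProduct` (L0; PROVED `cosetAsInnerProduct_holds`): `T_d = Σ_{a mod d} U_a V_a`.
* `ShellIdentity` (L1, FIRST LEMMA of the card; PROVED `shellIdentity_holds`): `d·T_d = Σ_{e ∣ d} P(e)` with the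
  Ramanujan shell `P(e) = Σ_{a,a' mod e} c_e(a − a') U^{[e]}_a V^{[e]}_{a'}`
  (`= Σ*_{b mod e} conj û(b/e) v̂(b/e)`, the exact-denominator-`e` Farey shell); `ShellMoebius`
  (L1'): `P(e) = Σ_{d ∣ e} μ(e/d) d T_d`.
* `MeanFluctuation` (L2; PROVED `meanFluctuation_holds`): `T_d = U_tot V_tot / d + Σ_a U'_a V'_a` (exact).
* `WelchFloor` (L3, tightness, pure linear algebra): `Σ_{i,i'} ⟨w_i, w_{i'}⟩² ≥ (Σ_i ‖w_i‖²)²/d`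
  for any family in `ℝ^d` — with `w_n = (U^{(n)}_a)_a`, `d = j ≍ √M`, `N = 2M` vectors of norm² `≍ M`
  this forces `rms_{n≠n'} |T_j(n,n')| ≫ M^{3/4}`: the exponent `3/4` (i.e. `ϑ ≥ 0`) is necessary.
* `OnePointAP η` (H1): Montgomery-type one-point hypothesis (square-root cancellation for additively
  twisted Liouville sums along the progressions `c mod n`, `n ≤ 2M`), the λ-analogue of
  Montgomery–Vaughan Conj. 13.9; it controls the mean term and every small shell by Cauchy–Schwarz.
* `TopShell η δ` (H2): the two-point core — ANY power saving below Cauchy–Schwarz for the shells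
  `e ∣ j` with `e ≥ M^{1/2−3η}`.
* `ShiftParseval` (L4): `Σ_{r mod d} (Σ_a U_a V_{a+r})² = (1/d) Σ_{b mod d} |û(b/d)|²|v̂(b/d)|²`, hence
  `GenericShift` (L4'): `OnePointAP η →` the crux bound holds for all but `j·M^{−2τ}` class offsets `r`.
* `CardOneAssembly` (A): `ShellIdentity → OnePointAP η → TopShell η δ → CosetDecorrelation`.
* `SquareCoincidences` (L5): the Rademacher-model mean / only deterministic `+1`-set
  `N_□ = #{m ≡ m' (j) : (mn+c)(m'n'+c) = □} ≤ C √M log M`.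
-/

namespace Summit.Parity.GeneralizedHardyLittlewood.Cruxes.CosetDecorrelation.SketchIdeator1

open scoped BigOperators FourierTransform
open Finset

/-- `u_{n,c}(m) = λ(mn + c)` in the route's spelling (`Int.toNat`, real-valued). -/
noncomputable def lamLin (n : ℕ) (c : ℤ) (m : ℕ) : ℝ :=
  (ArithmeticFunction.liouville (Int.toNat ((m : ℤ) * n + c)) : ℝ)

/-- Class sum `U^{(n)}_a(M; d) = Σ_{m ∈ (M,2M], m ≡ a (mod d)} λ(mn + c)`. -/
noncomputable def classSum (n : ℕ) (c : ℤ) (M d a : ℕ) : ℝ :=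
  ∑ m ∈ (Ioc M (2 * M)).filter (fun m => m ≡ a [MOD d]), lamLin n c m

/-- Coset sum `T_d(n, n'; c; M) = Σ_{(m,m') ∈ (M,2M]², m ≡ m' (mod d)} λ(mn + c) λ(m'n' + c)`
(the crux's sum, with the modulus `d` free). -/
noncomputable def cosetSum (n n' : ℕ) (c : ℤ) (M d : ℕ) : ℝ :=
  ∑ p ∈ (Ioc M (2 * M) ×ˢ Ioc M (2 * M)).filter (fun p : ℕ × ℕ => p.1 ≡ p.2 [MOD d]),
    lamLin n c p.1 * lamLin n' c p.2

/-- The coset sum is literally the sum bounded in the route decl `CosetDecorrelation`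
(same filter, same summand). -/
theorem cosetSum_eq_route (n n' : ℕ) (c : ℤ) (M j : ℕ) :
    cosetSum n n' c M j =
      ∑ p ∈ (Ioc M (2 * M) ×ˢ Ioc M (2 * M)).filter (fun p : ℕ × ℕ => p.1 ≡ p.2 [MOD j]),
        (ArithmeticFunction.liouville (Int.toNat ((p.1 : ℤ) * n + c)) : ℝ) *
          (ArithmeticFunction.liouville (Int.toNat ((p.2 : ℤ) * n' + c)) : ℝ) := rfl

/-- (L0) `T_d = ⟨U, V⟩`: the coset sum is the inner product of the two class-sum vectors. -/
def CosetAsInnerProduct : Prop :=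
  ∀ (n n' : ℕ) (c : ℤ) (M d : ℕ), 0 < d →
    cosetSum n n' c M d = ∑ a ∈ range d, classSum n c M d a * classSum n' c M d a

/-- Ramanujan's sum `c_e(h)` as a real number: the real part of the tree's
`Literature.NumberTheory.Sieve.ramanujanSum` (whose imaginary part vanishes, `ramanujanSum_im`; Kluyver's
identity `Σ_{d ∣ q} c_d(h) = q·1[q ∣ h]` is the tree's PROVED `sum_divisors_ramanujanSum_eq_ite` —
the engine of `ShellIdentity`). -/
noncomputable def ramanujanSum (e : ℕ) (h : ℤ) : ℝ :=
  (Literature.NumberTheory.Sieve.ramanujanSum e h).re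


/-- Kluyver's identity in the real form used by the shells (from the tree's
`sum_divisors_ramanujanSum_eq_ite`): `Σ_{e ∣ d} c_e(h) = d · 1[d ∣ h]`. -/
theorem sum_divisors_ramanujanSum_real {d : ℕ} (hd : d ≠ 0) (h : ℤ) :
    ∑ e ∈ d.divisors, ramanujanSum e h = if (d : ℤ) ∣ h then (d : ℝ) else 0 := by
  unfold ramanujanSum
  rw [← Complex.re_sum, Literature.NumberTheory.Sieve.sum_divisors_ramanujanSum_eq_ite hd]
  split_ifs <;> simp

/-- `e(h'/q) = e(h/q)` when `q ∣ h' − h`. -/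
theorem fourierChar_div_congr {q : ℕ} (hq : q ≠ 0) {h h' : ℤ} (hd : (q : ℤ) ∣ h' - h) :
    (𝐞 ((h' : ℝ) / q) : ℂ) = (𝐞 ((h : ℝ) / q) : ℂ) := by
  obtain ⟨k, hk⟩ := hd
  have hq' : (q : ℝ) ≠ 0 := Nat.cast_ne_zero.mpr hq
  have hh : (h' : ℤ) = h + q * k := by linarith
  have : (h' : ℝ) / q = (h : ℝ) / q + (k : ℝ) := by
    have hh' : (h' : ℝ) = h + q * k := by exact_mod_cast hh
    rw [hh']
    field_simp
  rw [this, AddChar.map_add_eq_mul, Circle.coe_mul,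
    Literature.NumberTheory.Sieve.RamanujanSum.fourierChar_intCast, mul_one]

/-- Periodicity of Ramanujan sums in `h`: `c_q(h') = c_q(h)` when `q ∣ h' − h`. PROVED. -/
theorem ramanujanSum_congr {q : ℕ} (hq : q ≠ 0) {h h' : ℤ} (hd : (q : ℤ) ∣ h' - h) :
    ramanujanSum q h' = ramanujanSum q h := by
  unfold ramanujanSum
  rw [Literature.NumberTheory.Sieve.ramanujanSum_def, Literature.NumberTheory.Sieve.ramanujanSum_def]
  congr 1
  refine sum_congr rfl fun a _ => ?_
  rw [Literature.NumberTheory.Sieve.RamanujanSum.fourierChar_mul_div_eq_pow,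
    Literature.NumberTheory.Sieve.RamanujanSum.fourierChar_mul_div_eq_pow, fourierChar_div_congr hq hd]

/-- Ramanujan shell `P(e) = Σ_{a, a' mod e} c_e(a − a') U^{[e]}_a V^{[e]}_{a'}`
(`= Σ_{(b,e)=1} conj û(b/e) · v̂(b/e)`, the exact-denominator-`e` Farey shell of `⟨û, v̂⟩`). -/
noncomputable def shellSum (n n' : ℕ) (c : ℤ) (M e : ℕ) : ℝ :=
  ∑ a ∈ range e, ∑ a' ∈ range e,
    ramanujanSum e ((a : ℤ) - a') * classSum n c M e a * classSum n' c M e a'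

/-- (L1) **Shell identity** (FIRST LEMMA of card `shells-and-shifts`): `d · T_d = Σ_{e ∣ d} P(e)`.
Proof sketch: `Σ_{e ∣ d} c_e(h) = d · 1[d ∣ h]` (Kluyver) applied to `h = m − m'`. -/
def ShellIdentity : Prop :=
  ∀ (n n' : ℕ) (c : ℤ) (M d : ℕ), 0 < d →
    (d : ℝ) * cosetSum n n' c M d = ∑ e ∈ d.divisors, shellSum n n' c M e

/-- Shell sum in general form = Ramanujan-weighted pair sum (engine of `ShellIdentity`). PROVED. -/
theorem shell_eq_pairSum (I : Finset ℕ) (f g : ℕ → ℝ) {e : ℕ} (he : 0 < e) :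
    ∑ a ∈ range e, ∑ a' ∈ range e,
        ramanujanSum e ((a : ℤ) - a') * (∑ m ∈ I.filter (fun m => m ≡ a [MOD e]), f m) *
          (∑ m ∈ I.filter (fun m => m ≡ a' [MOD e]), g m) =
      ∑ p ∈ I ×ˢ I, ramanujanSum e ((p.1 : ℤ) - p.2) * f p.1 * g p.2 := by
  classical
  symm
  have hmaps : ∀ p ∈ I ×ˢ I, (p.1 % e, p.2 % e) ∈ range e ×ˢ range e := by
    intro p _
    simp [Nat.mod_lt _ he]
  rw [← sum_fiberwise_of_maps_to hmaps, sum_product]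
  refine sum_congr rfl fun a ha => sum_congr rfl fun a' ha' => ?_
  have hae : a % e = a := Nat.mod_eq_of_lt (mem_range.mp ha)
  have hae' : a' % e = a' := Nat.mod_eq_of_lt (mem_range.mp ha')
  have hfib : (I ×ˢ I).filter (fun p : ℕ × ℕ => (p.1 % e, p.2 % e) = (a, a')) =
      (I.filter (fun m => m ≡ a [MOD e])) ×ˢ (I.filter (fun m => m ≡ a' [MOD e])) := by
    ext ⟨m, m'⟩
    simp only [mem_filter, mem_product, Prod.mk.injEq, Nat.ModEq, hae, hae']
    tauto
  rw [hfib, sum_product, mul_assoc, sum_mul_sum, mul_sum]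
  refine sum_congr rfl fun m hm => ?_
  rw [mul_sum]
  refine sum_congr rfl fun m' hm' => ?_
  have hm1 : m ≡ a [MOD e] := (mem_filter.mp hm).2
  have hm2 : m' ≡ a' [MOD e] := (mem_filter.mp hm').2
  have h1 : (e : ℤ) ∣ (a : ℤ) - m := Nat.modEq_iff_dvd.mp hm1
  have h2 : (e : ℤ) ∣ (a' : ℤ) - m' := Nat.modEq_iff_dvd.mp hm2
  have hdiv : (e : ℤ) ∣ ((m : ℤ) - m') - ((a : ℤ) - a') := by
    have : ((m : ℤ) - m') - ((a : ℤ) - a') = ((a' : ℤ) - m') - ((a : ℤ) - m) := by ring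
    rw [this]
    exact dvd_sub h2 h1
  rw [ramanujanSum_congr he.ne' hdiv]
  ring

/-- Shell identity in general form: `d · Σ_{m ≡ m' (d)} f(m)g(m') = Σ_{e ∣ d} Σ_{a,a'} c_e(a−a') F_a G_{a'}`. PROVED. -/
theorem shell_identity_general (I : Finset ℕ) (f g : ℕ → ℝ) {d : ℕ} (hd : 0 < d) :
    (d : ℝ) * ∑ p ∈ (I ×ˢ I).filter (fun p : ℕ × ℕ => p.1 ≡ p.2 [MOD d]), f p.1 * g p.2 =
      ∑ e ∈ d.divisors, ∑ a ∈ range e, ∑ a' ∈ range e,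
        ramanujanSum e ((a : ℤ) - a') * (∑ m ∈ I.filter (fun m => m ≡ a [MOD e]), f m) *
          (∑ m ∈ I.filter (fun m => m ≡ a' [MOD e]), g m) := by
  classical
  have hstep : ∀ e ∈ d.divisors, ∑ a ∈ range e, ∑ a' ∈ range e,
        ramanujanSum e ((a : ℤ) - a') * (∑ m ∈ I.filter (fun m => m ≡ a [MOD e]), f m) *
          (∑ m ∈ I.filter (fun m => m ≡ a' [MOD e]), g m) =
      ∑ p ∈ I ×ˢ I, ramanujanSum e ((p.1 : ℤ) - p.2) * f p.1 * g p.2 := by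
    intro e he
    exact shell_eq_pairSum I f g (Nat.pos_of_mem_divisors he)
  rw [sum_congr rfl hstep, sum_comm]
  simp_rw [mul_assoc, ← sum_mul]
  rw [sum_filter, mul_sum]
  refine sum_congr rfl fun p _ => ?_
  rw [sum_divisors_ramanujanSum_real hd.ne']
  have hiff : ((d : ℤ) ∣ (p.1 : ℤ) - p.2) ↔ p.1 ≡ p.2 [MOD d] := by
    rw [Nat.modEq_iff_dvd, dvd_sub_comm]
  by_cases hp : p.1 ≡ p.2 [MOD d]
  · rw [if_pos (hiff.mpr hp), if_pos hp]
  · rw [if_neg (fun h => hp (hiff.mp h)), if_neg hp]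
    simp

/-- (L1) holds — the card's FIRST LEMMA is a theorem: `d · T_d = Σ_{e ∣ d} P(e)`. PROVED. -/
theorem shellIdentity_holds : ShellIdentity := by
  intro n n' c M d hd
  exact shell_identity_general _ _ _ hd

/-- (L1') Möbius form of the shells: `P(e) = Σ_{d ∣ e} μ(e/d) · d · T_d`. -/
def ShellMoebius : Prop :=
  ∀ (n n' : ℕ) (c : ℤ) (M e : ℕ), 0 < e →
    shellSum n n' c M e =
      ∑ d ∈ e.divisors, (ArithmeticFunction.moebius (e / d) : ℝ) * d * cosetSum n n' c M d

/-- (L2) **Mean–fluctuation split** (exact): `T_d = U_tot V_tot / d + Σ_a U'_a V'_a`,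
`U'_a = U_a − U_tot/d`. The first term is ONE-POINT (product of two sums of `λ` along one
progression each); the second is the shell sum over `e ∣ d, e > 1`. -/
def MeanFluctuation : Prop :=
  ∀ (n n' : ℕ) (c : ℤ) (M d : ℕ), 0 < d →
    cosetSum n n' c M d =
      (∑ a ∈ range d, classSum n c M d a) * (∑ a ∈ range d, classSum n' c M d a) / d +
        ∑ a ∈ range d,
          (classSum n c M d a - (∑ b ∈ range d, classSum n c M d b) / d) *
            (classSum n' c M d a - (∑ b ∈ range d, classSum n' c M d b) / d)

/-- Class fibration of the coset pair-set (general finset `I`, general real sequences): the engine of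
`CosetAsInnerProduct`. -/
theorem sum_filter_modEq_prod_eq_sum_range (I : Finset ℕ) (f g : ℕ → ℝ) {d : ℕ} (hd : 0 < d) :
    ∑ p ∈ (I ×ˢ I).filter (fun p : ℕ × ℕ => p.1 ≡ p.2 [MOD d]), f p.1 * g p.2 =
      ∑ a ∈ range d, (∑ m ∈ I.filter (fun m => m ≡ a [MOD d]), f m) *
        (∑ m ∈ I.filter (fun m => m ≡ a [MOD d]), g m) := by
  classical
  have hmaps : ∀ p ∈ (I ×ˢ I).filter (fun p : ℕ × ℕ => p.1 ≡ p.2 [MOD d]), p.1 % d ∈ range d := by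
    intro p _
    exact mem_range.mpr (Nat.mod_lt _ hd)
  rw [← sum_fiberwise_of_maps_to hmaps]
  refine sum_congr rfl fun a ha => ?_
  have ha' : a < d := mem_range.mp ha
  have hmod : a % d = a := Nat.mod_eq_of_lt ha'
  rw [sum_mul_sum, ← sum_product']
  refine sum_congr ?_ fun _ _ => rfl
  ext ⟨m, m'⟩
  simp only [mem_filter, mem_product, Nat.ModEq, hmod]
  constructor
  · rintro ⟨⟨⟨hm, hm'⟩, hmm⟩, hma⟩
    exact ⟨⟨hm, hma⟩, hm', hmm ▸ hma⟩
  · rintro ⟨⟨hm, hma⟩, hm', hma'⟩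
    exact ⟨⟨⟨hm, hm'⟩, hma.trans hma'.symm⟩, hma⟩

/-- (L0) holds: `T_d = Σ_{a mod d} U_a V_a`. PROVED. -/
theorem cosetAsInnerProduct_holds : CosetAsInnerProduct := by
  intro n n' c M d hd
  exact sum_filter_modEq_prod_eq_sum_range _ _ _ hd

/-- Mean–fluctuation algebra on `ℝ^d`. -/
theorem sum_mul_eq_mean_add_fluct (d : ℕ) (hd : 0 < d) (U V : ℕ → ℝ) :
    ∑ a ∈ range d, U a * V a =
      (∑ a ∈ range d, U a) * (∑ a ∈ range d, V a) / d +
        ∑ a ∈ range d, (U a - (∑ b ∈ range d, U b) / d) * (V a - (∑ b ∈ range d, V b) / d) := by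
  have hd' : (d : ℝ) ≠ 0 := by exact_mod_cast hd.ne'
  simp only [sub_mul, mul_sub, sum_sub_distrib, ← sum_mul, ← mul_sum, sum_const, card_range,
    nsmul_eq_mul]
  field_simp
  ring

/-- (L2) holds: the mean–fluctuation split of the coset sum. PROVED. -/
theorem meanFluctuation_holds : MeanFluctuation := by
  intro n n' c M d hd
  rw [cosetAsInnerProduct_holds n n' c M d hd]
  exact sum_mul_eq_mean_add_fluct d hd _ _

/-- (L3) **Welch / frame-potential floor** (pure linear algebra; tightness lemma for the disprover):
for any `N` vectors `w_i ∈ ℝ^d`, `Σ_{i,i'} ⟨w_i, w_{i'}⟩² ≥ (Σ_i ‖w_i‖²)² / d`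
(`‖W Wᵀ‖_F = ‖Wᵀ W‖_F` and Cauchy–Schwarz on the trace of the `d × d` matrix `WᵀW`).
With `w_n = (U^{(n)}_a)_{a mod j}`, `n ≤ 2M`, `d = j`: `Σ_{n ≠ n'} T_j(n,n')² ≥ (Σ_n ‖U^{(n)}‖²)²/j − Σ_n ‖U^{(n)}‖⁴`,
so `‖U^{(n)}‖² ≍ M` forces `rms_{n ≠ n'} T_j ≫ M^{3/4}` — the exponent `3/4` cannot be lowered (`ϑ ≥ 0`). -/
def WelchFloor : Prop :=
  ∀ (d N : ℕ) (w : Fin N → Fin d → ℝ), 0 < d →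
    (∑ i, ∑ k, w i k ^ 2) ^ 2 / d ≤ ∑ i, ∑ i', (∑ k, w i k * w i' k) ^ 2

/-- (H1) **One-point hypothesis** `OnePointAP η` (Montgomery-type; conjecture-grade, the λ-analogue
of Montgomery–Vaughan Conj. 13.9 with an additive twist): for every shift `c ≠ 0` there is `C` with
`|Σ_{m ∈ (M,2M]} λ(mn + c) e(bm/e)| ≤ C M^{1/2+η}` for all `M`, all `1 ≤ n ≤ 2M`, all `1 ≤ e ≤ 2Q`,
all `b`. (Random-model true with `η = ε`; beyond GRH for `n > M^{o(1)}`; refutable in no known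
range: Maier/Granville–Soundararajan irregularities need progression length `≤ exp((log X)^{1/2−ε})`,
here the length is `M ≥ X^{1/2}`.) -/
def OnePointAP (η : ℝ) : Prop :=
  ∀ c : ℤ, c ≠ 0 → ∃ C : ℝ, ∀ M n e b : ℕ, 1 ≤ n → n ≤ 2 * M → 1 ≤ e → e ≤ 2 * (Nat.sqrt M + 1) →
    ‖∑ m ∈ Ioc M (2 * M),
        (lamLin n c m : ℂ) * Complex.exp (2 * Real.pi * Complex.I * ((b : ℂ) * m / e))‖
      ≤ C * (M : ℝ) ^ (1 / 2 + η)

/-- (H2) **Top-shell decorrelation** `TopShell η δ` (the two-point core of the crux): ANY power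
saving `M^{−δ}` below the Cauchy–Schwarz size `e·M` for the Ramanujan shells `P(e)` at the divisors
`e ∣ j` with `e ≥ M^{1/2 − 3η}` (for prime `j` this is the single shell `e = j`, i.e.
`|Σ_a U'_a V'_a| ≤ C M^{1−δ}`: power-small correlation of the two mean-zero class-sum vectors). -/
def TopShell (η δ : ℝ) : Prop :=
  ∀ c : ℤ, c ≠ 0 → ∃ C : ℝ, ∀ M n n' j e : ℕ, 1 ≤ n → 1 ≤ n' → n ≠ n' → n ≤ 2 * M → n' ≤ 2 * M →
    Nat.sqrt M + 1 ≤ j → j < 2 * (Nat.sqrt M + 1) → e ∣ j → (M : ℝ) ^ (1 / 2 - 3 * η) ≤ e →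
      |shellSum n n' c M e| ≤ C * e * (M : ℝ) ^ (1 - δ)


/-- Class-offset coset sums `T^{(r)}_d = Σ_{a mod d} U_a V_{a+r}` (`r = 0` is the crux's `T_d`; general `r`
pairs the class `a` of `m` with the class `a + r` of `m'`, i.e. the two-shift coset sum with second shift
`c + r n'` up to the range convention). -/
noncomputable def offsetCosetSum (n n' : ℕ) (c : ℤ) (M d r : ℕ) : ℝ :=
  ∑ a ∈ range d, classSum n c M d a * classSum n' c M d ((a + r) % d)

/-- (L4) **Shift Parseval** (dispersion over the relative class offset): for `0 < d`,
`Σ_{r mod d} (T^{(r)}_d)² = (1/d) Σ_{b mod d} |Û(b)|² |V̂(b)|²` with `Û(b) = Σ_a U_a e(ab/d) = û(b/d)`. -/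
def ShiftParseval : Prop :=
  ∀ (n n' : ℕ) (c : ℤ) (M d : ℕ), 0 < d →
    ∑ r ∈ range d, offsetCosetSum n n' c M d r ^ 2 =
      (1 / (d : ℝ)) * ∑ b ∈ range d,
        ‖∑ a ∈ range d, (classSum n c M d a : ℂ) *
            Complex.exp (2 * Real.pi * Complex.I * ((a : ℂ) * b / d))‖ ^ 2 *
        ‖∑ a ∈ range d, (classSum n' c M d a : ℂ) *
            Complex.exp (2 * Real.pi * Complex.I * ((a : ℂ) * b / d))‖ ^ 2

/-- (L4') **Generic offsets are fine under the one-point hypothesis** (rigorous consequence of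
`ShiftParseval` + `sup × L²`): `OnePointAP η` gives `Σ_r (T^{(r)}_j)² ≤ C⁴ M^{2+4η}`, hence
`rms_r T^{(r)}_j ≤ C² M^{3/4+2η}·(√M/j)^{1/2}` and at most `j·M^{−2τ}` offsets `r` violate
`|T^{(r)}_j| ≤ C² M^{3/4+2η+τ}`. The crux is the assertion that `r = 0` is never exceptional. -/
def GenericShift : Prop :=
  ∀ η : ℝ, 0 < η → OnePointAP η → ∀ c : ℤ, c ≠ 0 → ∃ C : ℝ, ∀ M n n' j : ℕ, ∀ τ : ℝ, 0 ≤ τ →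
    1 ≤ n → 1 ≤ n' → n ≤ 2 * M → n' ≤ 2 * M → Nat.sqrt M + 1 ≤ j → j < 2 * (Nat.sqrt M + 1) →
      (((range j).filter (fun r => C * (M : ℝ) ^ (3 / 4 + 2 * η + τ) < |offsetCosetSum n n' c M j r|)).card
          : ℝ) ≤ j * (M : ℝ) ^ (-2 * τ)

/-- (A) **Card-one assembly** (the composition the crux-plan skeleton would kernel-check):
shell identity + one-point hypothesis + top-shell decorrelation ⟹ the crux, with
`ϑ = 1/4 − min(η, δ) + o(1) < 1/4` (small shells: `|P(e)| ≤ φ(e) C² M^{1+2η}` by Cauchy–Schwarz from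
`OnePointAP`; there are `τ(j) = M^{o(1)}` shells). -/
def CardOneAssembly : Prop :=
  ShellIdentity →
    ∀ η δ : ℝ, 0 < η → η < 1 / 12 → 0 < δ → OnePointAP η → TopShell η δ →
      Summit.Parity.GeneralizedHardyLittlewood.Theses.LiouvilleMAD.CosetDecorrelation

/-- (L5) **Square coincidences** (the mean of `T_j` in the Rademacher random-multiplicative model, and a deterministic `+1`-bias set for
`λ` since `λ(x)λ(x') = +1` when `xx' = □`): for `c ≠ 0` there is `C` with
`#{(m,m') ∈ (M,2M]², m ≡ m' (mod j) : (mn+c)(m'n'+c) is a square} ≤ C √M log M` for all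
`M ≥ 2`, `1 ≤ n ≠ n' ≤ 2M`, `j ∈ [Q, 2Q)`. -/
def SquareCoincidences : Prop :=
  ∀ c : ℤ, c ≠ 0 → ∃ C : ℝ, ∀ M n n' j : ℕ, 2 ≤ M → 1 ≤ n → 1 ≤ n' → n ≠ n' → n ≤ 2 * M →
    n' ≤ 2 * M → Nat.sqrt M + 1 ≤ j → j < 2 * (Nat.sqrt M + 1) →
      (((Ioc M (2 * M) ×ˢ Ioc M (2 * M)).filter (fun p : ℕ × ℕ =>
          p.1 ≡ p.2 [MOD j] ∧ IsSquare (((p.1 : ℤ) * n + c) * ((p.2 : ℤ) * n' + c)))).card : ℝ)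
        ≤ C * Real.sqrt M * Real.log M

/-- (L6) **Scaling invariance** (bookkeeping used by both cards): `T_d(tn, tn'; tc) = T_d(n, n'; c)`
for `t ≥ 1` (complete multiplicativity: `λ(t(mn+c)) = λ(t) λ(mn+c)` and `λ(t)² = 1`), whenever all
arguments `mn + c` are positive. -/
def ScalingInvariance : Prop :=
  ∀ (n n' t : ℕ) (c : ℤ) (M d : ℕ), 1 ≤ t → (∀ m ∈ Ioc M (2 * M), 0 < (m : ℤ) * n + c) →
    (∀ m ∈ Ioc M (2 * M), 0 < (m : ℤ) * n' + c) →
      cosetSum (t * n) (t * n') (t * c) M d = cosetSum n n' c M d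

end Summit.Parity.GeneralizedHardyLittlewood.Cruxes.CosetDecorrelation.SketchIdeator1
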